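import Summits.HodgeConjecture.HodgeConjecture.Theorems.NikulinTwinTransportSquareHodgeOfSqrtTwo
import Literature.AlgebraicGeometry.HodgeTheory.GysinBaseChangeOfKunneth
import Literature.AlgebraicGeometry.Surfaces.K3Marking
import Literature.Geometry.Kaehler.HolomorphicChartForms
import Literature.AlgebraicGeometry.HodgeTheory.KunnethCrossProductsSpan

/-!
# Route NikulinTwinTransport · `SquareHodgeOfSqrtTwo` (stmt-HodgeConjecture-13680) —
# Künneth spanning as a named fact, and the fibre integral from it

The Künneth SPANNING input (Ksp) of `squareGlue_of_kunnethCriterion` (sibling file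
`NikulinTwinTransportSquareHodgeOfSqrtTwo`) stated as a NAMED FACT in the tree's vocabulary —
`Hatcher2002_crossProducts_span_complexBetti`: for smooth projective `Y, Z` over `ℂ` the cross products
`fst^* b ∪ snd^* w` span `H*((Y ⊗ Z)(ℂ); ℂ)` (Hatcher, *Algebraic Topology*, Thm. 3.15 over the field `ℂ`;
exactly the shape of the standing hypothesis `hK` of the tree's `gysin_baseChange_of_kunneth`) — with
its consequences for the route: the non-vanishing fibre integral `fst_*(snd^* p) = c₀ · 1`, `c₀ ≠ 0`
(`fibreIntegral_of_kunnethFact`; for K3 surfaces `fibreIntegral_K3_of_kunnethFact` = hypothesis (FI)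
of seat 3's reductions, symbol for symbol), hence the route decls BY NAME under named facts (and,
where present, the route's own antecedents / the Künneth criterion (K)) only:
`realMultiplicationSqrtTwoAlgebraic_of_kunnethFact` (13679 ⇐ X + facts),
`realMultiplicationGlue_of_kunnethFact` (13681 ⇐ facts),
`squareGlue_of_kunnethCriterion_of_kunnethFact` (13682 ⇐ (K) + facts),
`squareHodgeOfSqrtTwo_of_kunnethCriterion_of_kunnethFact` (13680 ⇐ (K) + facts + 13679 + 13678),
`assembly_of_kunnethCriterion_of_kunnethFact` (13942 ⇐ (K) + facts).
Prover seat prover-pitem-stmt-HodgeConjecture-13680-0.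
-/

noncomputable section

namespace Summit.HodgeConjecture.HodgeConjecture.Theorems.NikulinTwinTransport

open scoped Manifold
open Module CategoryTheory MonoidalCategory
open Literature.AlgebraicGeometry.Motives Literature.AlgebraicGeometry.HodgeTheory
open Literature.AlgebraicGeometry.Surfaces Literature.Geometry.Kaehler
open Literature.AlgebraicTopology.SingularHomology

/-- **The fibre integral of a non-zero top-degree class does not vanish** (`fst_*(snd^* p) = c₀ · 1`
with `c₀ ≠ 0` for `0 ≠ p ∈ H²ⁿ(S(ℂ); ℂ)`, `S` smooth projective of dimension `n`), granted Hatcher's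
Künneth spanning as a named fact (`fibreIntegral_of_kunnethSpan` fed with the fact). This is
hypothesis (FI) of `realMultiplicationSqrtTwoAlgebraic_of_fibreIntegral` for every smooth projective
`S`. [cite: HatcherAT2002, §3.2 Thm. 3.15 and §3.3 Thm. 3.30] -/
theorem fibreIntegral_of_kunnethFact (hKsp : Literature.AlgebraicGeometry.HodgeTheory.Hatcher2002_crossProducts_span_complexBetti)
    (μ : OrientationFamily) {n : ℕ} {S : SchemeOver ℂ} (hS : IsSmoothProjective n S)
    (p : complexBetti S (2 * n)) (hp : p ≠ 0) :
    ∃ c₀ : ℂ, c₀ ≠ 0 ∧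
      complexGysin μ (IsSmoothProjective.tensor_holds hS hS) hS (SemiCartesianMonoidalCategory.fst S S)
          (show 2 * n + 2 * n = 0 + 2 * (n + n) by omega)
          (complexBetti.map (SemiCartesianMonoidalCategory.snd S S) (2 * n) p) =
        c₀ • singularCohomology.one ℂ (ComplexPoints S) :=
  fibreIntegral_of_kunnethSpan μ hS (hKsp hS hS (2 * (n + n))) p hp

/-- **Hypothesis (FI) of the route's reductions, for projective K3 surfaces, from Hatcher's Künneth
spanning**: for the integral generator `p` of `H⁴(S(ℂ))` (non-zero, `generator_ne_zero`),
`fst_*(snd^* p) = c · 1` with `c ≠ 0` — symbol for symbol the hypothesis `hFI` of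
`realMultiplicationSqrtTwoAlgebraic_of_fibreIntegral`, `realMultiplicationGlue_of_fibreIntegral`,
`assembly_of_squareGlue_of_fibreIntegral`. [cite: HatcherAT2002, §3.2 Thm. 3.15] -/
theorem fibreIntegral_K3_of_kunnethFact (hKsp : Literature.AlgebraicGeometry.HodgeTheory.Hatcher2002_crossProducts_span_complexBetti) :
    ∀ (μ : OrientationFamily), μ.HasPoincareDuality →
      ∀ (S : SchemeOver ℂ)
        (hS : (IsSmoothProjective 2 S ∧ Subsingleton (structureSheafCohomology S.left 1) ∧
          ∃ (A : HodgeModel 2 S) (η : MForm 𝓘(ℝ, A.model) A.carrier ℂ 2),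
            IsHolomorphicInCharts η ∧ ∀ x, η x ≠ 0))
        (p : complexBetti S (2 * 2)),
        (IsIntegralClass p ∧ ∀ q : complexBetti S (2 * 2), IsIntegralClass q → ∃ n : ℤ, q = n • p) →
        ∃ c : ℂ, c ≠ 0 ∧
          complexGysin μ (IsSmoothProjective.tensor_holds hS.1 hS.1) hS.1
              (SemiCartesianMonoidalCategory.fst S S)
              (rfl : 2 * 2 + 2 * 2 = 0 + 2 * (2 + 2))
              (complexBetti.map (SemiCartesianMonoidalCategory.snd S S) (2 * 2) p) =
            c • singularCohomology.one ℂ (ComplexPoints S) :=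
  fun μ _ _ hS p hp => fibreIntegral_of_kunnethFact hKsp μ hS.1 p (generator_ne_zero hS hp.2)

/-- **`RealMultiplicationSqrtTwoAlgebraic` (stmt-HodgeConjecture-13679) from X = `TwinSimilitudeAlgebraic`
and NAMED FACTS only** (markings, Hodge types of `H²(K3)`, Grothendieck's coniveau bound, Hatcher's
Künneth spanning): seat 3's `realMultiplicationSqrtTwoAlgebraic_of_fibreIntegral` with (FI) discharged
from the Künneth fact. [cite: Varesco2023, Thm. 2.1 and Rem. 2.2] [cite: HatcherAT2002, §3.2 Thm. 3.15] -/
theorem realMultiplicationSqrtTwoAlgebraic_of_kunnethFact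
    (hX : Theses.NikulinTwinTransport.TwinSimilitudeAlgebraic)
    (hmark : Huybrechts_K3_marking_exists) (hHT : Huybrechts_K3_hodgeTypes_H2)
    (hG : Grothendieck1969_supportedClasses_le_hodgeConiveau)
    (hKsp : Literature.AlgebraicGeometry.HodgeTheory.Hatcher2002_crossProducts_span_complexBetti) :
    Theses.NikulinTwinTransport.RealMultiplicationSqrtTwoAlgebraic :=
  realMultiplicationSqrtTwoAlgebraic_of_fibreIntegral hX hmark hHT
    (fun _ hS _ hd => isOfHodgeType_oneOne_of_mem_algebraicClasses hG hS hd)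
    (fibreIntegral_K3_of_kunnethFact hKsp)

/-- **`RealMultiplicationGlue` (stmt-HodgeConjecture-13681) from NAMED FACTS only.**
[cite: Varesco2023, Thm. 2.1 and Rem. 2.2] [cite: HatcherAT2002, §3.2 Thm. 3.15] -/
theorem realMultiplicationGlue_of_kunnethFact
    (hmark : Huybrechts_K3_marking_exists) (hHT : Huybrechts_K3_hodgeTypes_H2)
    (hG : Grothendieck1969_supportedClasses_le_hodgeConiveau)
    (hKsp : Literature.AlgebraicGeometry.HodgeTheory.Hatcher2002_crossProducts_span_complexBetti) :
    Theses.NikulinTwinTransport.RealMultiplicationGlue :=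
  realMultiplicationGlue_of_fibreIntegral hmark hHT hG (fibreIntegral_K3_of_kunnethFact hKsp)

/-- **`SquareGlue` modulo the Künneth criterion (K) and named facts only** (Künneth spanning now the
registered fact `Hatcher2002_crossProducts_span_complexBetti`). [cite: Varesco2023, §2 (p. 8)]
[cite: HatcherAT2002, §3.2 Thm. 3.15] -/
theorem squareGlue_of_kunnethCriterion_of_kunnethFact
    (hK : ∀ (μ : OrientationFamily), μ.HasPoincareDuality → ∀ (S : SchemeOver ℂ)
      (hS : IsSmoothProjective 2 S ∧ Subsingleton (structureSheafCohomology S.left 1) ∧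
        ∃ (A : HodgeModel 2 S) (η : MForm 𝓘(ℝ, A.model) A.carrier ℂ 2),
          IsHolomorphicInCharts η ∧ ∀ x, η x ≠ 0),
      (∀ G : complexBetti S (2 * 1) →ₗ[ℂ] complexBetti S (2 * 1),
        (∀ x, IsRationalClass x → IsRationalClass (G x)) →
        (∀ (i j : ℕ) x, IsOfHodgeType 2 S (2 * 1) i j x → IsOfHodgeType 2 S (2 * 1) i j (G x)) →
        ∃ γ ∈ algebraicClasses (S ⊗ S) 2, ∀ x : complexBetti S (2 * 1),
          G x = complexGysin μ (IsSmoothProjective.tensor_holds hS.1 hS.1) hS.1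
            (SemiCartesianMonoidalCategory.fst S S)
            (rfl : 2 * 1 + 2 * 2 + 2 * 2 = 2 * 1 + 2 * (2 + 2))
            (cupProduct (rfl : 2 * 1 + 2 * 2 = 2 * 1 + 2 * 2)
              (complexBetti.map (SemiCartesianMonoidalCategory.snd S S) (2 * 1) x) γ)) →
      (∀ c : complexBetti S (2 * 1), IsRationalClass c → IsOfHodgeType 2 S (2 * 1) 1 1 c →
        c ∈ algebraicClasses S 1) →
      HodgeConjectureFor 4 (S ⊗ S))
    (hKsp : Literature.AlgebraicGeometry.HodgeTheory.Hatcher2002_crossProducts_span_complexBetti)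
    (hmark : Huybrechts_K3_marking_exists) (hHT : Huybrechts_K3_hodgeTypes_H2)
    (hG : Grothendieck1969_supportedClasses_le_hodgeConiveau) :
    Theses.NikulinTwinTransport.SquareGlue :=
  squareGlue_of_kunnethCriterion hK hKsp hmark hHT hG

/-- **`SquareHodgeOfSqrtTwo` (stmt-HodgeConjecture-13680) modulo the Künneth criterion (K), named
facts, and its two route antecedents** (`RealMultiplicationSqrtTwoAlgebraic`, stmt-13679, open;
`LefschetzOneOneK3`, stmt-13678). [cite: Varesco2023, §2 (p. 8)] -/
theorem squareHodgeOfSqrtTwo_of_kunnethCriterion_of_kunnethFact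
    (hK : ∀ (μ : OrientationFamily), μ.HasPoincareDuality → ∀ (S : SchemeOver ℂ)
      (hS : IsSmoothProjective 2 S ∧ Subsingleton (structureSheafCohomology S.left 1) ∧
        ∃ (A : HodgeModel 2 S) (η : MForm 𝓘(ℝ, A.model) A.carrier ℂ 2),
          IsHolomorphicInCharts η ∧ ∀ x, η x ≠ 0),
      (∀ G : complexBetti S (2 * 1) →ₗ[ℂ] complexBetti S (2 * 1),
        (∀ x, IsRationalClass x → IsRationalClass (G x)) →
        (∀ (i j : ℕ) x, IsOfHodgeType 2 S (2 * 1) i j x → IsOfHodgeType 2 S (2 * 1) i j (G x)) →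
        ∃ γ ∈ algebraicClasses (S ⊗ S) 2, ∀ x : complexBetti S (2 * 1),
          G x = complexGysin μ (IsSmoothProjective.tensor_holds hS.1 hS.1) hS.1
            (SemiCartesianMonoidalCategory.fst S S)
            (rfl : 2 * 1 + 2 * 2 + 2 * 2 = 2 * 1 + 2 * (2 + 2))
            (cupProduct (rfl : 2 * 1 + 2 * 2 = 2 * 1 + 2 * 2)
              (complexBetti.map (SemiCartesianMonoidalCategory.snd S S) (2 * 1) x) γ)) →
      (∀ c : complexBetti S (2 * 1), IsRationalClass c → IsOfHodgeType 2 S (2 * 1) 1 1 c →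
        c ∈ algebraicClasses S 1) →
      HodgeConjectureFor 4 (S ⊗ S))
    (hKsp : Literature.AlgebraicGeometry.HodgeTheory.Hatcher2002_crossProducts_span_complexBetti)
    (hmark : Huybrechts_K3_marking_exists) (hHT : Huybrechts_K3_hodgeTypes_H2)
    (hG : Grothendieck1969_supportedClasses_le_hodgeConiveau)
    (hRM : Theses.NikulinTwinTransport.RealMultiplicationSqrtTwoAlgebraic)
    (hL : Theses.NikulinTwinTransport.LefschetzOneOneK3) :
    Theses.NikulinTwinTransport.SquareHodgeOfSqrtTwo :=
  squareGlue_of_kunnethCriterion hK hKsp hmark hHT hG hRM hL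

/-- **The route's frame `Assembly` (stmt-HodgeConjecture-13942) modulo the Künneth criterion (K) and
NAMED FACTS only** (`assembly_of_squareGlue_of_fibreIntegral` fed with `squareGlue_of_kunnethCriterion`
and the Künneth fact). [cite: Varesco2023, §2 (p. 8)] [cite: HatcherAT2002, §3.2 Thm. 3.15] -/
theorem assembly_of_kunnethCriterion_of_kunnethFact
    (hK : ∀ (μ : OrientationFamily), μ.HasPoincareDuality → ∀ (S : SchemeOver ℂ)
      (hS : IsSmoothProjective 2 S ∧ Subsingleton (structureSheafCohomology S.left 1) ∧
        ∃ (A : HodgeModel 2 S) (η : MForm 𝓘(ℝ, A.model) A.carrier ℂ 2),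
          IsHolomorphicInCharts η ∧ ∀ x, η x ≠ 0),
      (∀ G : complexBetti S (2 * 1) →ₗ[ℂ] complexBetti S (2 * 1),
        (∀ x, IsRationalClass x → IsRationalClass (G x)) →
        (∀ (i j : ℕ) x, IsOfHodgeType 2 S (2 * 1) i j x → IsOfHodgeType 2 S (2 * 1) i j (G x)) →
        ∃ γ ∈ algebraicClasses (S ⊗ S) 2, ∀ x : complexBetti S (2 * 1),
          G x = complexGysin μ (IsSmoothProjective.tensor_holds hS.1 hS.1) hS.1
            (SemiCartesianMonoidalCategory.fst S S)
            (rfl : 2 * 1 + 2 * 2 + 2 * 2 = 2 * 1 + 2 * (2 + 2))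
            (cupProduct (rfl : 2 * 1 + 2 * 2 = 2 * 1 + 2 * 2)
              (complexBetti.map (SemiCartesianMonoidalCategory.snd S S) (2 * 1) x) γ)) →
      (∀ c : complexBetti S (2 * 1), IsRationalClass c → IsOfHodgeType 2 S (2 * 1) 1 1 c →
        c ∈ algebraicClasses S 1) →
      HodgeConjectureFor 4 (S ⊗ S))
    (hKsp : Literature.AlgebraicGeometry.HodgeTheory.Hatcher2002_crossProducts_span_complexBetti)
    (hmark : Huybrechts_K3_marking_exists) (hHT : Huybrechts_K3_hodgeTypes_H2)
    (hG : Grothendieck1969_supportedClasses_le_hodgeConiveau) :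
    Theses.NikulinTwinTransport.Assembly :=
  assembly_of_squareGlue_of_fibreIntegral (squareGlue_of_kunnethCriterion hK hKsp hmark hHT hG)
    hmark hHT hG (fibreIntegral_K3_of_kunnethFact hKsp)

end Summit.HodgeConjecture.HodgeConjecture.Theorems.NikulinTwinTransport

end
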